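import Summits.AnomalousDissipation.AnomalousDissipation.Theorems.FloorCertificate.Negative.Uniform

/-!
# `TaylorCertificates.FloorCertificate` (stmt-AnomalousDissipation-14091) — negative side III:
# tightness of the stubs of line `dissipation-deficit-duality` (drefute findings)

Kernel-checked small models for the stub set of the lead's skeleton
`Cruxes/FloorCertificate/Lines/dissipation-deficit-duality.lean` (reshape 1, stubs S0–S5; seat
`refuter-drefute-stmt-AnomalousDissipation-14091-0`, 2026-08-16). No stub is refuted; what is recorded
here is which hypotheses are LOAD-BEARING (any proof must use them) and which degenerate corners hold.

* §1 S2 `stub_fanMinimax` (Ky Fan's convex-like minimax principle, γ-form): EVERY hypothesis is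
  necessary — dropping `CompactSpace X` (`X = Y = ℝ`, `φ = y − x`), lower semicontinuity
  (`X = [0,1]`, `φ = y − x⁻¹` with Lean's `0⁻¹ = 0`), convex-likeness (`X = Bool`, matching pennies),
  concave-likeness (`Y = Bool`, matching pennies) or `Nonempty Y` (`X = Y = Empty`) makes the statement
  FALSE; the corner `X = ∅` of S2 itself holds (so `Nonempty X` is rightly absent).
* §2 S3a `stub_cylindricalCombination`, corner `a = b = 0`: a FLAT cylindrical test functional
  (`m = 0`) exists, `Φ₀' ≡ 0` — the zero multiplier used by S3/S4.
* §3 S5 `stub_relaxedEnsembleFloor` (the open bet): its inner block is FALSE at the junk force `f = 0`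
  (so the `∃ f` must pick `f ≠ 0`, dual mirror of `floorFamily_force_ne_zero`), FALSE for EVERY force once
  the Liouville clause is dropped (the Dirac mass AT REST is then admissible and quiet — dual face of
  `floor_at_rest`), and FALSE for every force once `IsProbabilityMeasure μ` is dropped (zero measure).
-/

noncomputable section

set_option linter.dupNamespace false

open MeasureTheory UnitAddTorus Filter Topology
open scoped InnerProductSpace ENNReal

namespace Summit.AnomalousDissipation.AnomalousDissipation.Theorems.FloorCertificate.Negative

open Literature.Analysis.FunctionSpaces Literature.Analysis.FluidPDE
open Summit.AnomalousDissipation.AnomalousDissipation.Theses.TaylorCertificates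
open Summit.AnomalousDissipation.AnomalousDissipation.Theorems.TaylorCertificatePair.Negative

/-- Local notation: real vector fields on `T³`. -/
local notation "Vec3" => (UnitAddTorus (Fin 3)) → (EuclideanSpace ℝ (Fin 3))
/-- Local notation: `L²(T³; ℝ³)`. -/
local notation "L2" => (Lp (EuclideanSpace ℝ (Fin 3)) 2 (volume : Measure (UnitAddTorus (Fin 3))))
/-- Local notation: the energy space `H`. -/
local notation "H3" => (Torus.energySpace (Fin 3))

/-! ## §1 Every hypothesis of S2 (`stub_fanMinimax`) is necessary -/

/-- **Compactness of `X` is necessary in S2**: `X = Y = ℝ`, `φ x y = y − x` is continuous, affine in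
each variable (hence convex-like and concave-like), every `x` is beaten (`y = x + 1`), no `y` beats all `x`. -/
theorem fanMinimax_false_without_compact :
    ¬ ∀ (X Y : Type) [TopologicalSpace X] [Nonempty Y] (φ : X → Y → ℝ),
      (∀ y : Y, LowerSemicontinuous fun x : X => φ x y) →
      (∀ (x₁ x₂ : X) (t : ℝ), 0 ≤ t → t ≤ 1 → ∃ x₀ : X, ∀ y : Y, φ x₀ y ≤ t * φ x₁ y + (1 - t) * φ x₂ y) →
      (∀ (y₁ y₂ : Y) (t : ℝ), 0 ≤ t → t ≤ 1 → ∃ y₀ : Y, ∀ x : X, t * φ x y₁ + (1 - t) * φ x y₂ ≤ φ x y₀) →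
      ∀ γ : ℝ, (∀ x : X, ∃ y : Y, γ < φ x y) → ∃ y : Y, ∀ x : X, γ < φ x y := by
  intro h
  obtain ⟨y, hy⟩ := h ℝ ℝ (fun x y => y - x)
    (fun y => (continuous_const.sub continuous_id).lowerSemicontinuous)
    (fun x₁ x₂ t _ _ => ⟨t * x₁ + (1 - t) * x₂, fun y => le_of_eq (by ring)⟩)
    (fun y₁ y₂ t _ _ => ⟨t * y₁ + (1 - t) * y₂, fun x => le_of_eq (by ring)⟩)
    0 (fun x => ⟨x + 1, by linarith⟩)
  have := hy y
  linarith

/-- **Lower semicontinuity is necessary in S2**: `X = [0,1]` (compact), `Y = ℝ`, `φ x y = y − x⁻¹`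
(Lean's `0⁻¹ = 0`; unbounded below near `x = 0`, not lsc at `0`), convex-like (pick the endpoint with the
larger `x⁻¹`), affine in `y`; every `x` is beaten, but `x = (|y|+2)⁻¹` defeats any `y`. -/
theorem fanMinimax_false_without_lsc :
    ¬ ∀ (X Y : Type) [TopologicalSpace X] [CompactSpace X] [Nonempty Y] (φ : X → Y → ℝ),
      (∀ (x₁ x₂ : X) (t : ℝ), 0 ≤ t → t ≤ 1 → ∃ x₀ : X, ∀ y : Y, φ x₀ y ≤ t * φ x₁ y + (1 - t) * φ x₂ y) →
      (∀ (y₁ y₂ : Y) (t : ℝ), 0 ≤ t → t ≤ 1 → ∃ y₀ : Y, ∀ x : X, t * φ x y₁ + (1 - t) * φ x y₂ ≤ φ x y₀) →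
      ∀ γ : ℝ, (∀ x : X, ∃ y : Y, γ < φ x y) → ∃ y : Y, ∀ x : X, γ < φ x y := by
  intro h
  obtain ⟨y, hy⟩ := h (Set.Icc (0 : ℝ) 1) ℝ (fun x y => y - (x : ℝ)⁻¹)
    (fun x₁ x₂ t ht0 ht1 => by
      by_cases hle : ((x₁ : ℝ))⁻¹ ≤ ((x₂ : ℝ))⁻¹
      · exact ⟨x₂, fun y => by nlinarith [mul_le_mul_of_nonneg_left hle ht0]⟩
      · push Not at hle
        exact ⟨x₁, fun y => by nlinarith [mul_le_mul_of_nonneg_left hle.le (sub_nonneg.2 ht1)]⟩)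
    (fun y₁ y₂ t _ _ => ⟨t * y₁ + (1 - t) * y₂, fun x => le_of_eq (by ring)⟩)
    0 (fun x => ⟨(x : ℝ)⁻¹ + 1, by linarith⟩)
  have hmem : (|y| + 2)⁻¹ ∈ Set.Icc (0 : ℝ) 1 :=
    ⟨by positivity, inv_le_one_of_one_le₀ (by linarith [abs_nonneg y])⟩
  have := hy ⟨(|y| + 2)⁻¹, hmem⟩
  simp only [inv_inv] at this
  linarith [le_abs_self y]

/-- **Convex-likeness in `x` is necessary in S2** (matching pennies, pure `x` against mixed `y`):
`X = Bool` (compact, discrete — every `φ(·,y)` is continuous), `Y = ℝ`, `φ x p = cond x p (1 − p)`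
(affine in `p`, hence concave-like), `γ = 1/2`: each `x` is beaten, no `p` has `p > 1/2` and `1 − p > 1/2`. -/
theorem fanMinimax_false_without_convexLike :
    ¬ ∀ (X Y : Type) [TopologicalSpace X] [CompactSpace X] [Nonempty Y] (φ : X → Y → ℝ),
      (∀ y : Y, LowerSemicontinuous fun x : X => φ x y) →
      (∀ (y₁ y₂ : Y) (t : ℝ), 0 ≤ t → t ≤ 1 → ∃ y₀ : Y, ∀ x : X, t * φ x y₁ + (1 - t) * φ x y₂ ≤ φ x y₀) →
      ∀ γ : ℝ, (∀ x : X, ∃ y : Y, γ < φ x y) → ∃ y : Y, ∀ x : X, γ < φ x y := by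
  intro h
  obtain ⟨y, hy⟩ := h Bool ℝ (fun x p => cond x p (1 - p))
    (fun p => continuous_of_discreteTopology.lowerSemicontinuous)
    (fun y₁ y₂ t _ _ => ⟨t * y₁ + (1 - t) * y₂, fun x => by
      cases x <;> simp only [cond_true, cond_false] <;> linarith⟩)
    (1 / 2) (fun x => by
      cases x
      · exact ⟨0, by simp only [cond_false]; norm_num⟩
      · exact ⟨1, by simp only [cond_true]; norm_num⟩)
  have h1 := hy true
  have h2 := hy false
  simp only [cond_true, cond_false] at h1 h2
  linarith

/-- **Concave-likeness in `y` is necessary in S2** (matching pennies, mixed `x` against pure `y`):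
`X = [0,1]`, `Y = Bool`, `φ q y = cond y q (1 − q)` (continuous and affine in `q`, hence lsc and
convex-like), `γ = 2/5`: each `q` is beaten (`max(q, 1−q) ≥ 1/2`), neither pure `y` beats `q = 0` resp. `q = 1`. -/
theorem fanMinimax_false_without_concaveLike :
    ¬ ∀ (X Y : Type) [TopologicalSpace X] [CompactSpace X] [Nonempty Y] (φ : X → Y → ℝ),
      (∀ y : Y, LowerSemicontinuous fun x : X => φ x y) →
      (∀ (x₁ x₂ : X) (t : ℝ), 0 ≤ t → t ≤ 1 → ∃ x₀ : X, ∀ y : Y, φ x₀ y ≤ t * φ x₁ y + (1 - t) * φ x₂ y) →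
      ∀ γ : ℝ, (∀ x : X, ∃ y : Y, γ < φ x y) → ∃ y : Y, ∀ x : X, γ < φ x y := by
  intro h
  obtain ⟨y, hy⟩ := h (Set.Icc (0 : ℝ) 1) Bool (fun q y => cond y (q : ℝ) (1 - q))
    (fun y => by
      cases y
      · simp only [cond_false]
        exact (continuous_const.sub continuous_subtype_val).lowerSemicontinuous
      · simp only [cond_true]
        exact continuous_subtype_val.lowerSemicontinuous)
    (fun x₁ x₂ t ht0 ht1 => by
      refine ⟨⟨t * x₁ + (1 - t) * x₂, ?_, ?_⟩, fun y => ?_⟩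
      · nlinarith [x₁.2.1, x₂.2.1]
      · nlinarith [x₁.2.2, x₂.2.2]
      · cases y <;> simp only [cond_true, cond_false] <;> linarith)
    (2 / 5) (fun x => by
      by_cases hq : (1 / 2 : ℝ) < x
      · exact ⟨true, by simp only [cond_true]; linarith⟩
      · exact ⟨false, by simp only [cond_false]; linarith [x.2.2]⟩)
  cases y
  · have := hy ⟨1, by norm_num, by norm_num⟩
    simp only [cond_false] at this
    linarith
  · have := hy ⟨0, by norm_num, by norm_num⟩
    simp only [cond_true] at this
    linarith

/-- **`Nonempty Y` is necessary in S2**: with `X = Y = Empty` every hypothesis is vacuous and the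
conclusion `∃ y : Empty, …` fails. -/
theorem fanMinimax_false_without_nonempty :
    ¬ ∀ (X Y : Type) [TopologicalSpace X] [CompactSpace X] (φ : X → Y → ℝ),
      (∀ y : Y, LowerSemicontinuous fun x : X => φ x y) →
      (∀ (x₁ x₂ : X) (t : ℝ), 0 ≤ t → t ≤ 1 → ∃ x₀ : X, ∀ y : Y, φ x₀ y ≤ t * φ x₁ y + (1 - t) * φ x₂ y) →
      (∀ (y₁ y₂ : Y) (t : ℝ), 0 ≤ t → t ≤ 1 → ∃ y₀ : Y, ∀ x : X, t * φ x y₁ + (1 - t) * φ x y₂ ≤ φ x y₀) →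
      ∀ γ : ℝ, (∀ x : X, ∃ y : Y, γ < φ x y) → ∃ y : Y, ∀ x : X, γ < φ x y := by
  intro h
  obtain ⟨y, -⟩ := h Empty Empty (fun x => x.elim) (fun y => y.elim) (fun x₁ => x₁.elim)
    (fun y₁ => y₁.elim) 0 (fun x => x.elim)
  exact y.elim

/-- The corner `X = ∅` of S2 itself HOLDS (trivially, through `Nonempty Y`) — so `Nonempty X` is rightly
not a hypothesis of the stub, and the game of S3 may be played on an empty sublevel set. -/
theorem fanMinimax_of_isEmpty (X Y : Type) [IsEmpty X] [Nonempty Y] (φ : X → Y → ℝ) (γ : ℝ) :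
    ∃ y : Y, ∀ x : X, γ < φ x y :=
  ⟨Classical.arbitrary Y, fun x => isEmptyElim x⟩

/-! ## §2 The corner `a = b = 0` of S3a (`stub_cylindricalCombination`): the flat test functional -/

/-- **A flat cylindrical test functional exists** (`m = 0`, zero profile): `Φ₀'(u) = 0` at every state —
the zero multiplier `(Φ₀, θ = 0)` of the class `Y_L` in S3, and the `a = b = 0` instance of S3a on every ball. -/
theorem exists_cylindricalTest_grad_eq_zero :
    ∃ Φ₀ : Torus.CylindricalTest (Fin 3), ∀ u : H3, Φ₀.grad u = 0 := by
  refine ⟨⟨0, fun i => i.elim0, fun i => i.elim0, fun i => i.elim0, fun i => i.elim0, 0, contDiff_const,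
      ?_⟩, fun u => ?_⟩
  · simpa using (HasCompactSupport.zero : HasCompactSupport (0 : EuclideanSpace ℝ (Fin 0) → ℝ))
  · funext x
    simp [Torus.CylindricalTest.grad]

/-- S3a at `a = b = 0`, every radius: realised by the flat functional. -/
theorem cylindricalCombination_zero_zero (ρ : ℝ) (Φ₁ Φ₂ : Torus.CylindricalTest (Fin 3)) :
    ∃ Φ₀ : Torus.CylindricalTest (Fin 3), ∀ u : H3, ‖u‖ ^ 2 ≤ ρ →
      Φ₀.grad u = (0 : ℝ) • Φ₁.grad u + (0 : ℝ) • Φ₂.grad u := by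
  obtain ⟨Φ₀, h⟩ := exists_cylindricalTest_grad_eq_zero
  exact ⟨Φ₀, fun u _ => by rw [h, zero_smul, zero_smul, add_zero]⟩

/-! ## §3 Load-bearing clauses of S5 (`stub_relaxedEnsembleFloor`) -/

/-- **S5 fails at the junk force `f = 0`** (its `∃ f` must pick a nonzero force): at every `ν > 0` the
Dirac mass at rest is a relaxed stationary statistic of `NS_ν(0)` on the Leray ball `{0}` — probability,
carried by the ball, zero enstrophy, Liouville (`⟨F(0), Φ'(0)⟩ = (0, Φ'(0)) = 0`), energy inequality
`0 ≤ 0` — of ZERO dissipation. Dual-class mirror of `floorFamily_force_ne_zero`. -/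
theorem relaxedEnsembleFloor_false_at_zero_force :
    ¬ ∃ ε₀ ν₀ : ℝ, 0 < ε₀ ∧ 0 < ν₀ ∧ ∀ ν : ℝ, 0 < ν → ν < ν₀ →
      ∀ μ : Measure (Torus.energySpace (Fin 3)),
        IsProbabilityMeasure μ →
        (∀ᵐ u ∂μ, ‖u‖ ^ 2 ≤ 16 * (∫ x, ‖(0 : Vec3) x‖ ^ 2) / ν ^ 2) →
        Torus.ensembleEnstrophy μ < ⊤ →
        (∀ Φ : Torus.CylindricalTest (Fin 3),
          Integrable (fun u => Torus.nsGeneratorPairing ν (0 : Vec3) u (Φ.grad u)) μ ∧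
            ∫ u, Torus.nsGeneratorPairing ν (0 : Vec3) u (Φ.grad u) ∂μ = 0) →
        Integrable (fun u : Torus.energySpace (Fin 3) => Torus.pairing u.1 (0 : Vec3)) μ →
        Torus.ensembleDissipation ν μ ≤ ∫ u, Torus.pairing u.1 (0 : Vec3) ∂μ →
        ε₀ ≤ Torus.ensembleDissipation ν μ := by
  haveI : MeasurableSingletonClass H3 := ⟨fun _ => isClosed_singleton.measurableSet⟩
  rintro ⟨ε₀, ν₀, hε₀, hν₀, h⟩
  have hν : (0 : ℝ) < ν₀ / 2 := half_pos hν₀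
  set μ : Measure H3 := Measure.dirac (0 : H3) with hμ
  have hZ : Torus.ensembleEnstrophy μ = 0 := by
    unfold Torus.ensembleEnstrophy
    rw [hμ, lintegral_dirac, eGradNormSq_coe_zero]
  have hD : Torus.ensembleDissipation (ν₀ / 2) μ = 0 := by
    rw [Torus.ensembleDissipation, hZ, ENNReal.toReal_zero, mul_zero]
  have hgen0 : ∀ W : Vec3, Torus.nsGeneratorPairing (ν₀ / 2) (0 : Vec3) (0 : H3) W = 0 := by
    intro W
    rw [nsGeneratorPairing_of_ae coe_zero_ae]
    simp
  have hpair0 : Torus.pairing ((0 : H3) : L2) (0 : Vec3) = 0 := by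
    rw [pairing_of_ae coe_zero_ae]
    simp
  have hconst : ∀ (g : H3 → ℝ), Integrable g μ := fun g => by
    have hae : g =ᵐ[μ] fun _ => g 0 := by
      rw [hμ, ae_dirac_eq]
      exact Filter.eventually_pure.2 rfl
    exact (integrable_const (g 0)).congr hae.symm
  have key := h (ν₀ / 2) hν (by linarith) μ inferInstance
    (by
      rw [hμ, ae_dirac_eq]
      refine Filter.eventually_pure.2 ?_
      simp)
    (by rw [hZ]; exact ENNReal.zero_lt_top)
    (fun Φ => ⟨hconst _, by rw [hμ, integral_dirac]; exact hgen0 _⟩)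
    (hconst _)
    (by rw [hD, hμ, integral_dirac]; exact le_of_eq hpair0.symm)
  rw [hD] at key
  linarith

/-- **Any proof of S5 must use the Liouville clause**: with it dropped, the Dirac mass AT REST is an
admissible quiet measure for EVERY force and every `ν > 0` (`D = 0`, `(0, f) = 0`, energy inequality
`0 ≤ 0`) — the dual face of `floor_at_rest` (a certificate must push against `f` at rest). -/
theorem relaxedEnsembleFloor_false_without_liouville (f : Vec3) :
    ¬ ∃ ε₀ ν₀ : ℝ, 0 < ε₀ ∧ 0 < ν₀ ∧ ∀ ν : ℝ, 0 < ν → ν < ν₀ →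
      ∀ μ : Measure (Torus.energySpace (Fin 3)),
        IsProbabilityMeasure μ →
        (∀ᵐ u ∂μ, ‖u‖ ^ 2 ≤ 16 * (∫ x, ‖f x‖ ^ 2) / ν ^ 2) →
        Torus.ensembleEnstrophy μ < ⊤ →
        Integrable (fun u : Torus.energySpace (Fin 3) => Torus.pairing u.1 f) μ →
        Torus.ensembleDissipation ν μ ≤ ∫ u, Torus.pairing u.1 f ∂μ →
        ε₀ ≤ Torus.ensembleDissipation ν μ := by
  haveI : MeasurableSingletonClass H3 := ⟨fun _ => isClosed_singleton.measurableSet⟩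
  rintro ⟨ε₀, ν₀, hε₀, hν₀, h⟩
  have hν : (0 : ℝ) < ν₀ / 2 := half_pos hν₀
  set μ : Measure H3 := Measure.dirac (0 : H3) with hμ
  have hZ : Torus.ensembleEnstrophy μ = 0 := by
    unfold Torus.ensembleEnstrophy
    rw [hμ, lintegral_dirac, eGradNormSq_coe_zero]
  have hD : Torus.ensembleDissipation (ν₀ / 2) μ = 0 := by
    rw [Torus.ensembleDissipation, hZ, ENNReal.toReal_zero, mul_zero]
  have hpair0 : Torus.pairing ((0 : H3) : L2) f = 0 := by
    rw [pairing_of_ae coe_zero_ae]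
    simp
  have hconst : ∀ (g : H3 → ℝ), Integrable g μ := fun g => by
    have hae : g =ᵐ[μ] fun _ => g 0 := by
      rw [hμ, ae_dirac_eq]
      exact Filter.eventually_pure.2 rfl
    exact (integrable_const (g 0)).congr hae.symm
  have hF : 0 ≤ 16 * (∫ x, ‖f x‖ ^ 2) / (ν₀ / 2) ^ 2 := by
    have : 0 ≤ ∫ x, ‖f x‖ ^ 2 := integral_nonneg fun x => by positivity
    positivity
  have key := h (ν₀ / 2) hν (by linarith) μ inferInstance
    (by
      rw [hμ, ae_dirac_eq]
      refine Filter.eventually_pure.2 ?_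
      simpa using hF)
    (by rw [hZ]; exact ENNReal.zero_lt_top)
    (hconst _)
    (by rw [hD, hμ, integral_dirac]; exact le_of_eq hpair0.symm)
  rw [hD] at key
  linarith

/-- **Any proof of S5 must use `IsProbabilityMeasure μ`** (the normalisation of the dual object): the
ZERO measure satisfies every other clause, for every force and every `ν`, with zero dissipation. -/
theorem relaxedEnsembleFloor_false_without_probability (f : Vec3) :
    ¬ ∃ ε₀ ν₀ : ℝ, 0 < ε₀ ∧ 0 < ν₀ ∧ ∀ ν : ℝ, 0 < ν → ν < ν₀ →
      ∀ μ : Measure (Torus.energySpace (Fin 3)),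
        (∀ᵐ u ∂μ, ‖u‖ ^ 2 ≤ 16 * (∫ x, ‖f x‖ ^ 2) / ν ^ 2) →
        Torus.ensembleEnstrophy μ < ⊤ →
        (∀ Φ : Torus.CylindricalTest (Fin 3),
          Integrable (fun u => Torus.nsGeneratorPairing ν f u (Φ.grad u)) μ ∧
            ∫ u, Torus.nsGeneratorPairing ν f u (Φ.grad u) ∂μ = 0) →
        Integrable (fun u : Torus.energySpace (Fin 3) => Torus.pairing u.1 f) μ →
        Torus.ensembleDissipation ν μ ≤ ∫ u, Torus.pairing u.1 f ∂μ →
        ε₀ ≤ Torus.ensembleDissipation ν μ := by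
  rintro ⟨ε₀, ν₀, hε₀, hν₀, h⟩
  have hZ : Torus.ensembleEnstrophy (0 : Measure H3) = 0 := by
    unfold Torus.ensembleEnstrophy
    rw [lintegral_zero_measure]
  have hD : Torus.ensembleDissipation (ν₀ / 2) (0 : Measure H3) = 0 := by
    rw [Torus.ensembleDissipation, hZ, ENNReal.toReal_zero, mul_zero]
  have key := h (ν₀ / 2) (half_pos hν₀) (by linarith) 0 (by simp)
    (by rw [hZ]; exact ENNReal.zero_lt_top)
    (fun Φ => ⟨integrable_zero_measure, by rw [integral_zero_measure]⟩)
    integrable_zero_measure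
    (by rw [hD, integral_zero_measure])
  rw [hD] at key
  linarith

end Summit.AnomalousDissipation.AnomalousDissipation.Theorems.FloorCertificate.Negative

end
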